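import Summits.QuantumFields.BalabanUV.T4Continuum.Support.ShellMeasureLandauWilsonSquaresLocatedSchwarz
import Summits.QuantumFields.BalabanUV.T4Continuum.Support.ShellMeasureLandauPinnedFieldRadius

/-!
# `T4Continuum.ShellMeasureLandauWilsonSquaresKernelsSchwarzField` — row S112 f2: THE LOCATED TWO-RADII WILSON SUPPLIER AT THE
# READING OF RECORD WITH THE TWO PINNED CONTRACTION BUDGETS IN PRINT's FIELD-SIZE SHAPE — the twin of S85 f2 file 4
# `ShellMeasureLandauWilsonSquaresKernelsSchwarz` (leaf-09-g12) with S81's radius-Cauchy Lipschitz constants replaced by S112 f1's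
# field-radius ones: `hqW : B_𝒢p·(4C₄(ε₄+B₀b)e^{δ′r_W}) < 1`, `hk : 12C₂(ε₄+B₀b)e^{δ′r_C}·c_ι·B_H < 1`
(cell `pub-balaban`, sub-cell `t4`, spine estimate NE7c (node U5b); NE7c ROUND-2 crew, unit `b2b-balaban-t4-ne7c-formalise-leaf-07`
gen 10 — the S81 author lineage; owner table row **S112** (RULING R-ne7cp1-g36-14 (a)(ii) on FINDING F-ne7cleaf06g9-1 ∕ NOTE
N-ne7cleaf02g12-3); generated from the tree bytes of `ShellMeasureLandauWilsonSquaresKernelsSchwarz.lean` by the located substitutions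
listed below (script `gen_f2.py` in the lineage folder) and credits it and its pattern-giver leaf-04-g7 (`…WilsonSquaresKernels`);
ADDITIVE — imports S85 f2 file 2 `ShellMeasureLandauWilsonSquaresLocatedSchwarz` + S112 f1 `ShellMeasureLandauPinnedFieldRadius` ONLY;
[folklore]; 0 `def`, 0 `def … : Prop`, 0 sorry, 0 citation tags)

HONEST FRAMING.  Finite four-torus programme, rung (B)+1 only — NOT infinite volume, NOT a mass gap, NOT the Clay problem, NOT summit
progress; (B), `BetaPertHyp`, (B^μ) not consumed.  NE7c (`T4IndicatorShell.ShellWeightBound`) is NOT PRINTED in [Balaban 1983–89] and NOT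
PROVED; «NE7c ⇐ the named binders» (trigger c3).  Nothing printed is asserted; no estimate of Bałaban's is discharged.  HONEST
DEPENDENCY (cell): continuum YM on T⁴ ⇐ BetaPertH ∧ nine spine estimates (0/9 proved); BetaPertH ⇐ (D1) ∧ (D4) ∧ CAP+tail; G-an2-4
gates asym, D1 and NE2/3/4.

THE CHANGE (and nothing else).  In both theorems of the source file — `hE_landau_wilsonSquares_located_schwarz_of_kernels_field` (pinned letter
bounds `B_𝒢p c_ι B_H B₁ₚ`) and `…_of_decay` (those bounds from displayed decay kernels, `c·M·`) — the two DISPLAYED budgets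
`hqW : B_𝒢p·(2·C₄·a₃·e^{δ′r_W}) < 1`, `hk : 2·C₂·R·e^{δ′r_C}·c_ι·B_H < 1` (S81 f1∕f2: Cauchy at the ANALYTICITY radii `a₃`, `R`) become
**`hqW : B_𝒢p·(4·C₄·(ε₄ + B₀b)·e^{δ′r_W}) < 1`**, **`hk : 12·C₂·(ε₄ + B₀b)·e^{δ′r_C}·c_ι·B_H < 1`** (S112 f1 `hGWp_of_local_field`,
`hCp_of_local_field`: Cauchy at the FIELD radii `ε₄ + B₀b` ((121): `hdom` is `2ρ_W ≤ a₃`) and `3(ε₄ + B₀b)` ((54): `hRC` is `2ρ_C ≤ R`)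
— [Balaban1985Variational] (158) ∕ (53)–(54)'s FIELD-SIZE contraction factors with the pinned constants in the place of `B₀`, LOCATORS),
and the matching two factors of `z_pin` in the conclusions' constant:
`z_pin♯ = B₁ₚ·b∕((1 − B_𝒢p·(4C₄(ε₄+B₀b)e^{δ′r_W}))·(1 − 12C₂(ε₄+B₀b)e^{δ′r_C}·c_ι·B_H))`.  Every other binder, the proof skeleton (file 2
`hE_landau_wilsonSquares_located_schwarz` BY NAME with Sect. C at the passed radius, S69 (A) `opNorm_kerOpPin_le` ×4) VERBATIM.
WHY (F-ne7cleaf06g9-1): with `R := landauRad d L` downstream (S99 f3b) the old `hk` has `2·C2cov·landauRad ≤ 1` and no field-size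
factor — uninhabitable by designed letters; the new rows are field-size × pin factor × Schur products, as print.
CONSUMER (S112 f3 ∕ v6's root, the owner's scheduling): S80 f3 `ShellMeasureLandauEndRayStokesAssembledDecay`'s assembly re-rooted on
`…_of_decay` below — its rows `hqW hk` and the two `z_pin` factors of its slot constant change shape, nothing else.
NOTHING in the countdown moves; NE7c NOT PROVED; spine PROVED 0∕9.
-/


noncomputable section

open Set Metric NormedSpace
open scoped Matrix

namespace Summit.QuantumFields.BalabanUV.T4Continuum.ShellMeasureLandauWilsonSquaresKernelsSchwarzField

open Literature.MathematicalPhysics.QuantumFieldTheory.Balaban1983to89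
open B11Prop6Scheme (Prop4Hyp)
open T4ShellMeasurePlaquette (expTail₂)
open Summit.QuantumFields.BalabanUV.T4Continuum.ShellMeasureMultiGridNorms (WSup)
open Summit.QuantumFields.BalabanUV.T4Continuum.ShellMeasureDecayKernelSums (kerOp)
open Summit.QuantumFields.BalabanUV.T4Continuum.ShellMeasurePinnedNorm (pinW kerOpPin opNorm_kerOpPin_le)
open Summit.QuantumFields.BalabanUV.T4Continuum.ShellMeasureLandauHolonomy (solAt landauExp)
open Summit.QuantumFields.BalabanUV.T4Continuum.ShellMeasureLandauHolonomyChart (holOf cplx)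
open Summit.QuantumFields.BalabanUV.T4Continuum.ShellMeasureLandauPinnedFieldRadius (hCp_of_local_field hGWp_of_local_field)
open Summit.QuantumFields.BalabanUV.T4Continuum.ShellMeasureLandauPinnedKernels (norm_conj_kerOp_le hΦp_of_support)
open Summit.QuantumFields.BalabanUV.T4Continuum.ShellMeasureLandauWilsonSquaresLocatedSchwarz
  (hE_landau_wilsonSquares_located_schwarz)

variable {Λ Λz Λ' Λx Λb : Type*} [Fintype Λ] [DecidableEq Λ] [Fintype Λz] [Fintype Λ'] [Fintype Λx] [Fintype Λb]
variable {𝔄 ℭ 𝔄' 𝔅 𝔇 : Type*} [NormedAddCommGroup 𝔄] [NormedSpace ℂ 𝔄] [CompleteSpace 𝔄]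
  [NormedAddCommGroup ℭ] [NormedSpace ℂ ℭ] [NormedAddCommGroup 𝔄'] [NormedSpace ℂ 𝔄']
  [NormedAddCommGroup 𝔅] [NormedSpace ℂ 𝔅] [CompleteSpace 𝔅] [NormedAddCommGroup 𝔇] [NormedSpace ℂ 𝔇]
variable {nM : Type*} [Fintype nM] [DecidableEq nM] [Nonempty nM]

/-! ## §1 File 2 (S74 f3 at two radii) with the six pinned chain binders inhabited by S81 -/

section Kernels

open scoped Matrix.Norms.L2Operator

/-- **END-II's `hE` FOR THE WILSON PART, FULLY LOCATED, AT THE READING OF RECORD, TWO RADII — EVERY PINNED CHAIN BINDER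
INHABITED** (the two-radii twin of leaf-04-g7's S80 f2 `ShellMeasureLandauWilsonSquaresKernels.hE_landau_wilsonSquares_located_of_kernels`,
in exactly its pattern).  This row's file 2 `hE_landau_wilsonSquares_located_schwarz` with all five chain spaces FLAT pi-types
(`Λ → 𝔄`, `Λz → ℭ`, `Λ′ → 𝔄′`, `Λx → 𝔅`, `Λb → 𝔇`; sup norms), readings `(toPiL (pinW δ′ ϖ·) 1).symm` with pins
`ϖ ϖz ϖ′ ϖx ϖb`, `δ′ ≥ 0`.  FLAT lists VERBATIM ((P2) `h𝒢`, (P4) `hW`, (118)∕(121) at `a = B₀b`, (103) `hH₁`, (75)-TYPE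
`hΦd`∕`hΦ0`∕`hΦ`, (44) `hCq`∕`hCd` AT RADIUS `R` with **`hRC : 6(ε₄ + B₀b) ≤ R`** (Sect. C is run at `R∕2`), scaling `hι`, (46)
`hH`, (54) `hq`) with the located number **`h2S : 2S ≤ r_Φ`** (S85's inner radius); the four LINEAR letters AS KERNEL OPERATORS
`kerOp k𝒢 ∕ kι ∕ kH ∕ kH₁` with bounds `B_𝒢p c_ι B_H B₁ₚ` on their S69 conjugates (S69 (A)'s OUTPUT SHAPE — DISPLAYED decay
halves); LOCALITY of the (P4) letter (`NW`, reach `r_W`) and of the (44) letter (`NC`, reach `r_C`); the coarse field SUPPORTED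
ON THE BLOCK `{ϖb ≤ 0}`; smallness `B_𝒢p·(2C₄a₃e^{δ′r_W}) < 1`, `2C₂R·e^{δ′r_C}·c_ι·B_H < 1`; the weight read-outs (blind off
`supp p` at depth `ϖP p ≥ 0`, flat op-norms `κ̄_w`, curl op-norm `κ̄_c`, lengths `≤ m_w`, skew on `𝓡𝒴`), the real structure,
the unitary background plaquettes `‖B_p − 1‖ ≤ d_p ≤ d̄` and the located count `Σ_p e^{−δ′ϖP p} ≤ K` VERBATIM.  The six pinned
chain binders are supplied IN-PROOF by S81 (f2 `hGWp_of_local`, f1 `hCp_of_local`, f2 `norm_conj_kerOp_le` ×3, `hΦp_of_support`)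
BY NAME.  CONCLUSION: END-II's `hE` for the Wilson ray profile `𝓔_W y := Σ_{p∈P_w} β(1 − Re tr(B_p·holOf (ℓw p) Z y)∕N)` with the
SECOND-ORDER located constant **`B_𝓔 = 3·|β|·((d̄ + 2S̄∕(r_Φ∕S))·(2S̄∕(r_Φ∕S)))·K`** (no `1∕(r_Φ∕S − 1)`),
`S̄ = κ̄_c z_pin + expTail₂(m_w(κ̄_w z_pin))`, `z_pin = B₁ₚ·b∕((1 − B_𝒢p·(2C₄a₃e^{δ′r_W}))(1 − 2C₂R·e^{δ′r_C}·c_ι·B_H))`.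
Nothing printed is asserted; no estimate of Bałaban's discharged; NE7c NOT PROVED. [folklore] -/
theorem hE_landau_wilsonSquares_located_schwarz_of_kernels_field {n : ℕ} {𝔭 : Type*} {W : Set (Fin n → ℝ)} {Pw : Finset 𝔭} {S : ℝ}
    (hS : 0 < S) (hWS : W ⊆ closedBall (0 : Fin n → ℝ) S)
    {δ' : ℝ} (hδ' : 0 ≤ δ') (ϖ : Λ → ℝ) (ϖz : Λz → ℝ) (ϖ' : Λ' → ℝ) (ϖx : Λx → ℝ) (ϖb : Λb → ℝ)
    -- the four linear letters as kernel operators, with bounds on their S69 conjugates (DISPLAYED decay halves)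
    (k𝒢 : Λ → Λz → (ℭ →L[ℂ] 𝔄)) (kι : Λ' → Λ → (𝔄 →L[ℂ] 𝔄')) (kH : Λ → Λx → (𝔅 →L[ℂ] 𝔄))
    (kH₁ : Λ → Λb → (𝔇 →L[ℂ] 𝔄)) {B𝒢p cι BH B₁p : ℝ} (hB𝒢p : 0 ≤ B𝒢p) (hcι : 0 ≤ cι) (hBH : 0 ≤ BH)
    (hB₁p : 0 ≤ B₁p) (h𝒢p : ‖kerOpPin k𝒢 δ' ϖz ϖ‖ ≤ B𝒢p) (hιp : ‖kerOpPin kι δ' ϖ ϖ'‖ ≤ cι)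
    (hHp : ‖kerOpPin kH δ' ϖx ϖ‖ ≤ BH) (hH₁p : ‖kerOpPin kH₁ δ' ϖb ϖ‖ ≤ B₁p)
    -- the flat lists
    {W𝒱 : (Λ → 𝔄) → (Λz → ℭ)} {B₀ C₄ a₃ ε₄ b : ℝ}
    (h𝒢 : ∀ f, ‖kerOp k𝒢 f‖ ≤ B₀ * ‖f‖) (hW : Prop4Hyp W𝒱 C₄ a₃) (hB₀ : 0 < B₀) (hC₄ : 0 ≤ C₄) (hε₄ : 0 ≤ ε₄)
    (hdom : 2 * (ε₄ + B₀ * b) ≤ a₃) (hself : B₀ * C₄ * (ε₄ + B₀ * b) ^ 2 ≤ ε₄)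
    (hcontr : 4 * B₀ * C₄ * (ε₄ + B₀ * b) < 1) (hH₁ : ∀ B, ‖kerOp kH₁ B‖ ≤ B₀ * ‖B‖)
    {Φ : (Fin n → ℂ) → (Λb → 𝔇)} {rΦ : ℝ} (hΦd : DifferentiableOn ℂ Φ (ball 0 rΦ)) (hΦ0 : Φ 0 = 0)
    (hΦ : ∀ z ∈ ball (0 : Fin n → ℂ) rΦ, ‖Φ z‖ < b) (h2S : 2 * S ≤ rΦ)
    {C : (Λ' → 𝔄') → (Λx → 𝔅)} {C₂ R : ℝ} (hC₂ : 0 ≤ C₂) (hCq : ∀ Z : Λ' → 𝔄', ‖Z‖ < R → ‖C Z‖ ≤ C₂ * ‖Z‖ ^ 2)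
    (hCd : DifferentiableOn ℂ C (ball 0 R)) (hι : ∀ Y, ‖kerOp kι Y‖ ≤ ‖Y‖) (hH : ∀ X, ‖kerOp kH X‖ ≤ B₀ * ‖X‖)
    (hq : 9 * C₂ * B₀ * (ε₄ + B₀ * b) < 1) (hRC : 6 * (ε₄ + B₀ * b) ≤ R)
    -- localities with reaches (in place of `hGWp`'s `W`-half and of `hCp`) and the block support (in place of `hΦp`)
    (NW : Λz → Λ → Prop) (hlocW : ∀ A A' : Λ → 𝔄, ∀ c, (∀ b', NW c b' → A b' = A' b') → W𝒱 A c = W𝒱 A' c)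
    {rW : ℝ} (hreachW : ∀ c b', NW c b' → ϖz c - rW ≤ ϖ b')
    (NC : Λx → Λ' → Prop) (hlocC : ∀ A A' : Λ' → 𝔄', ∀ c, (∀ b', NC c b' → A b' = A' b') → C A c = C A' c)
    {rC : ℝ} (hreachC : ∀ c b', NC c b' → ϖx c - rC ≤ ϖ' b')
    (hsupp : ∀ z : Fin n → ℂ, ∀ i, 0 < ϖb i → Φ z i = 0)
    -- smallness of the two contraction numbers in the pinned currency (DISPLAYED arithmetic)
    (hqW : B𝒢p * (4 * C₄ * (ε₄ + B₀ * b) * Real.exp (δ' * rW)) < 1) (hk : 12 * C₂ * (ε₄ + B₀ * b) * Real.exp (δ' * rC) * cι * BH < 1)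
    -- the weight read-outs: BLIND off located supports, FLAT op-norms, curl op-norm (DISPLAYED), lengths
    (ℓw : 𝔭 → List ((Λ → 𝔄) →L[ℂ] Matrix nM nM ℂ)) (supp : 𝔭 → Finset Λ) (ϖP : 𝔭 → ℝ)
    (hblind : ∀ p ∈ Pw, ∀ ℓ ∈ ℓw p, ∀ A A' : Λ → 𝔄, (∀ b' ∈ supp p, A b' = A' b') → ℓ A = ℓ A')
    (hdepth : ∀ p ∈ Pw, ∀ b' ∈ supp p, ϖP p ≤ ϖ b') (hϖP : ∀ p ∈ Pw, 0 ≤ ϖP p)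
    {κw' κc' : ℝ} (hκw' : 0 ≤ κw') (hκc' : 0 ≤ κc') (hℓw : ∀ p ∈ Pw, ∀ ℓ ∈ ℓw p, ‖ℓ‖ ≤ κw')
    (hcurl : ∀ p ∈ Pw, ‖(ℓw p).sum‖ ≤ κc')
    {mw : ℕ} (hlenw : ∀ p ∈ Pw, (ℓw p).length ≤ mw)
    -- the real structure (chain (A)) with SKEW weight read-outs (chain (E))
    (𝓡𝒴 : AddSubgroup (Λ → 𝔄)) (h𝓡𝒴 : IsClosed (𝓡𝒴 : Set (Λ → 𝔄))) (𝓡𝒵 : AddSubgroup (Λz → ℭ))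
    (𝓡𝒴' : AddSubgroup (Λ' → 𝔄')) (𝓡𝒳 : AddSubgroup (Λx → 𝔅)) (h𝓡𝒳 : IsClosed (𝓡𝒳 : Set (Λx → 𝔅)))
    (𝓡ℬ : AddSubgroup (Λb → 𝔇))
    (h𝒢r : ∀ f ∈ 𝓡𝒵, kerOp k𝒢 f ∈ 𝓡𝒴) (hWr : ∀ Y ∈ 𝓡𝒴, W𝒱 Y ∈ 𝓡𝒵) (hιr : ∀ Y ∈ 𝓡𝒴, kerOp kι Y ∈ 𝓡𝒴')
    (hHr : ∀ X ∈ 𝓡𝒳, kerOp kH X ∈ 𝓡𝒴) (hCr : ∀ Z ∈ 𝓡𝒴', C Z ∈ 𝓡𝒳) (hH₁r : ∀ B ∈ 𝓡ℬ, kerOp kH₁ B ∈ 𝓡𝒴)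
    (hΦr : ∀ y : Fin n → ℝ, ‖y‖ ≤ S → Φ (cplx y) ∈ 𝓡ℬ)
    (hskew : ∀ p ∈ Pw, ∀ ℓ ∈ ℓw p, ∀ Y ∈ 𝓡𝒴, ℓ Y ∈ skewAdjoint (Matrix nM nM ℂ))
    -- the frozen background plaquettes (N-ne7cp1-g31-2) and the located count
    (Bp : 𝔭 → Matrix nM nM ℂ) {d : 𝔭 → ℝ} {dbar : ℝ} (hBu : ∀ p ∈ Pw, Bp p ∈ unitary (Matrix nM nM ℂ))
    (hBd : ∀ p ∈ Pw, ‖Bp p - 1‖ ≤ d p) (hd : ∀ p ∈ Pw, d p ≤ dbar) (hdbar : 0 ≤ dbar)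
    {K : ℝ} (hK : ∑ p ∈ Pw, Real.exp (-(δ' * ϖP p)) ≤ K) (β : ℝ) :
    ∀ x ∈ W, ∀ c : ℝ, 1 / 2 ≤ c → c ≤ 1 →
      (fun y => ∑ p ∈ Pw, β * (1 - (Matrix.trace (Bp p * holOf (ℓw p) (fun y => landauExp C (kerOp kι) (kerOp kH)
        (4 * C₂ * (ε₄ + B₀ * b) ^ 2) (solAt (kerOp k𝒢) 0 W𝒱 ε₄ (0 : Λz → ℭ) (kerOp kH₁ (Φ (cplx y))) +
          kerOp kH₁ (Φ (cplx y)))) y)).re / Fintype.card nM)) (c • x) ≤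
      (fun y => ∑ p ∈ Pw, β * (1 - (Matrix.trace (Bp p * holOf (ℓw p) (fun y => landauExp C (kerOp kι) (kerOp kH)
        (4 * C₂ * (ε₄ + B₀ * b) ^ 2) (solAt (kerOp k𝒢) 0 W𝒱 ε₄ (0 : Λz → ℭ) (kerOp kH₁ (Φ (cplx y))) +
          kerOp kH₁ (Φ (cplx y)))) y)).re / Fintype.card nM)) x +
        (1 - c) * (3 * (|β| * ((dbar +
          2 * (κc' * (B₁p * b / ((1 - B𝒢p * (4 * C₄ * (ε₄ + B₀ * b) * Real.exp (δ' * rW))) *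
              (1 - 12 * C₂ * (ε₄ + B₀ * b) * Real.exp (δ' * rC) * cι * BH))) +
            expTail₂ (mw * (κw' * (B₁p * b / ((1 - B𝒢p * (4 * C₄ * (ε₄ + B₀ * b) * Real.exp (δ' * rW))) *
              (1 - 12 * C₂ * (ε₄ + B₀ * b) * Real.exp (δ' * rC) * cι * BH)))))) / (rΦ / S)) *
          (2 * (κc' * (B₁p * b / ((1 - B𝒢p * (4 * C₄ * (ε₄ + B₀ * b) * Real.exp (δ' * rW))) *
              (1 - 12 * C₂ * (ε₄ + B₀ * b) * Real.exp (δ' * rC) * cι * BH))) +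
            expTail₂ (mw * (κw' * (B₁p * b / ((1 - B𝒢p * (4 * C₄ * (ε₄ + B₀ * b) * Real.exp (δ' * rW))) *
              (1 - 12 * C₂ * (ε₄ + B₀ * b) * Real.exp (δ' * rC) * cι * BH)))))) / (rΦ / S))) * K)) := by
  have hrΦ : 0 < rΦ := by linarith
  have hb : 0 < b := by have h := hΦ 0 (mem_ball_self hrΦ); rwa [hΦ0, norm_zero] at h
  have hε : 0 < ε₄ + B₀ * b := add_pos_of_nonneg_of_pos hε₄ (mul_pos hB₀ hb)
  -- Sect. C's flat list at the FIELD radius `ρ := 3(ε₄ + B₀b)` (`2ρ ≤ R` is `hRC`)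
  set ρ : ℝ := 3 * (ε₄ + B₀ * b) with hρ
  have hρ0 : 0 < ρ := by rw [hρ]; positivity
  have hρR : 2 * ρ ≤ R := by rw [hρ]; linarith
  have hCq' : ∀ Z : Λ' → 𝔄', ‖Z‖ < ρ → ‖C Z‖ ≤ C₂ * ‖Z‖ ^ 2 := fun Z hZ => hCq Z (hZ.trans_le (by linarith))
  have hCd' : DifferentiableOn ℂ C (ball 0 ρ) := hCd.mono (ball_subset_ball (by linarith))
  have hRC' : 3 * (ε₄ + B₀ * b) ≤ ρ := le_of_eq hρ.symm
  -- the six pinned chain binders, inhabited by S112 f1 (the two Lipschitz letters AT THE FIELD RADIUS) and S81 f2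
  have hGWp := hGWp_of_local_field hδ' ϖ ϖz k𝒢 hB𝒢p h𝒢p NW hlocW hreachW hC₄ hdom hε hW
  have hCp := hCp_of_local_field hδ' ϖ' ϖx NC hlocC hreachC hC₂ hρ0 hρR hCq hCd
  have hLC : 4 * C₂ * ρ * Real.exp (δ' * rC) = 12 * C₂ * (ε₄ + B₀ * b) * Real.exp (δ' * rC) := by rw [hρ]; ring
  have hk' : 4 * C₂ * ρ * Real.exp (δ' * rC) * cι * BH < 1 := by rw [hLC]; exact hk
  have h := hE_landau_wilsonSquares_located_schwarz hS hWS h𝒢 hW hB₀ hC₄ hε₄ hdom hself hcontr (kerOp kH₁) hH₁ hΦd hΦ0 hΦ h2S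
    hC₂ hCq' hCd' (kerOp kι) hι (kerOp kH) hH hq hRC' hδ' ϖ
    (WSup.toPiL (𝔄 := 𝔄') (pinW δ' ϖ') 1).symm.toContinuousLinearMap
    (WSup.toPiL (𝔄 := 𝔅) (pinW δ' ϖx) 1).symm.toContinuousLinearMap
    (WSup.toPiL (𝔄 := 𝔇) (pinW δ' ϖb) 1).symm.toContinuousLinearMap hGWp hqW
    (fun A A' hA hA' => by simpa only [ContinuousLinearEquiv.coe_coe] using hCp A A' hA hA')
    (fun Y => by simpa only [ContinuousLinearEquiv.coe_coe] using norm_conj_kerOp_le kι δ' ϖ ϖ' hιp Y)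
    (fun X => by simpa only [ContinuousLinearEquiv.coe_coe] using norm_conj_kerOp_le kH δ' ϖx ϖ hHp X)
    (by positivity) hcι hBH hk' hB₁p
    (fun B => by simpa only [ContinuousLinearEquiv.coe_coe] using norm_conj_kerOp_le kH₁ δ' ϖb ϖ hH₁p B)
    (fun z hz => by simpa only [ContinuousLinearEquiv.coe_coe] using hΦp_of_support hδ' ϖb hsupp hΦ z hz) hb.le
    ℓw supp ϖP hblind hdepth hϖP hκw' hκc' hℓw hcurl hlenw 𝓡𝒴 h𝓡𝒴 𝓡𝒵 𝓡𝒴' 𝓡𝒳 h𝓡𝒳 𝓡ℬ h𝒢r hWr hιr hHr hCr hH₁r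
    hΦr hskew Bp hBu hBd hd hdbar hK β
  rw [hLC] at h
  exact h

end Kernels

/-! ## §2 … and with the four linear letters' pinned bounds read from displayed decay kernels (S69 (A)) -/

section Decay

open scoped Matrix.Norms.L2Operator

variable {𝔖 : Type*}

/-- **THE LOCATED TWO-RADII WILSON SUPPLIER WITH NOTHING PINNED LEFT DISPLAYED** (twin of leaf-04-g7's
`hE_landau_wilsonSquares_located_of_decay`).  §1 with ONE pin profile `ϖ : 𝔖 → ℝ` on a common position space, one-sided
`ρ`-Lipschitz (`ϖ x ≤ ϖ y + ρ x y`), composed with the position maps `pos posz pos′ posx posb` of the five index types, and the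
four conjugate bounds DISCHARGED by S69 (A) `opNorm_kerOpPin_le` from DISPLAYED DECAY KERNELS `‖k c b‖ ≤ c₀·e^{−δρ(pos c, pos b)}`
((3.133)∕Thm 3.3, (46), (103) decay-halves TYPE — LOCATORS, not assertions) with reduced-rate row sums
`Σ_b e^{−(δ−δ′)ρ(x, pos b)} ≤ M` per letter: `B_𝒢p := c_𝒢M_𝒢`, `c_ι := c_ιM_ι`, `B_H := c_HM_H`, `B₁ₚ := c₁M₁`.  CONCLUSION = §1's
with these products (`2S ≤ r_Φ`; constant `3·|β|·((d̄ + 2S̄∕(r_Φ∕S))·(2S̄∕(r_Φ∕S)))·K`,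
`z_pin = (c₁M₁)·b∕((1 − (c_𝒢M_𝒢)·(2C₄a₃e^{δ′r_W}))(1 − 2C₂R·e^{δ′r_C}·(c_ιM_ι)·(c_HM_H)))`) — the (T2) supplier of the final host
`ShellMeasureLandauEndRayStokesAssembledDecay`.  Nothing printed is asserted; no estimate of Bałaban's discharged; NE7c NOT
PROVED. [folklore] -/
theorem hE_landau_wilsonSquares_located_schwarz_of_decay_field {n : ℕ} {𝔭 : Type*} {W : Set (Fin n → ℝ)} {Pw : Finset 𝔭} {S : ℝ}
    (hS : 0 < S) (hWS : W ⊆ closedBall (0 : Fin n → ℝ) S)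
    {δ' : ℝ} (hδ' : 0 ≤ δ') (ϖ : 𝔖 → ℝ) (ρ : 𝔖 → 𝔖 → ℝ) (hϖ : ∀ x y, ϖ x ≤ ϖ y + ρ x y)
    (pos : Λ → 𝔖) (posz : Λz → 𝔖) (pos' : Λ' → 𝔖) (posx : Λx → 𝔖) (posb : Λb → 𝔖)
    -- the four linear letters as DECAY KERNELS with reduced-rate row sums (DISPLAYED)
    (k𝒢 : Λ → Λz → (ℭ →L[ℂ] 𝔄)) (kι : Λ' → Λ → (𝔄 →L[ℂ] 𝔄')) (kH : Λ → Λx → (𝔅 →L[ℂ] 𝔄))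
    (kH₁ : Λ → Λb → (𝔇 →L[ℂ] 𝔄)) {c𝒢 δ𝒢 M𝒢 cι δι Mι cH δH MH c₁ δ₁ M₁ : ℝ}
    (hc𝒢 : 0 ≤ c𝒢) (hM𝒢 : 0 ≤ M𝒢) (hk𝒢 : ∀ c b', ‖k𝒢 c b'‖ ≤ c𝒢 * Real.exp (-(δ𝒢 * ρ (pos c) (posz b'))))
    (hM𝒢' : ∀ x, ∑ b', Real.exp (-((δ𝒢 - δ') * ρ x (posz b'))) ≤ M𝒢)
    (hcι : 0 ≤ cι) (hMι : 0 ≤ Mι) (hkι : ∀ c b', ‖kι c b'‖ ≤ cι * Real.exp (-(δι * ρ (pos' c) (pos b'))))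
    (hMι' : ∀ x, ∑ b', Real.exp (-((δι - δ') * ρ x (pos b'))) ≤ Mι)
    (hcH : 0 ≤ cH) (hMH : 0 ≤ MH) (hkH : ∀ c b', ‖kH c b'‖ ≤ cH * Real.exp (-(δH * ρ (pos c) (posx b'))))
    (hMH' : ∀ x, ∑ b', Real.exp (-((δH - δ') * ρ x (posx b'))) ≤ MH)
    (hc₁ : 0 ≤ c₁) (hM₁ : 0 ≤ M₁) (hkH₁ : ∀ c b', ‖kH₁ c b'‖ ≤ c₁ * Real.exp (-(δ₁ * ρ (pos c) (posb b'))))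
    (hM₁' : ∀ x, ∑ b', Real.exp (-((δ₁ - δ') * ρ x (posb b'))) ≤ M₁)
    -- the flat lists
    {W𝒱 : (Λ → 𝔄) → (Λz → ℭ)} {B₀ C₄ a₃ ε₄ b : ℝ}
    (h𝒢 : ∀ f, ‖kerOp k𝒢 f‖ ≤ B₀ * ‖f‖) (hW : Prop4Hyp W𝒱 C₄ a₃) (hB₀ : 0 < B₀) (hC₄ : 0 ≤ C₄) (hε₄ : 0 ≤ ε₄)
    (hdom : 2 * (ε₄ + B₀ * b) ≤ a₃) (hself : B₀ * C₄ * (ε₄ + B₀ * b) ^ 2 ≤ ε₄)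
    (hcontr : 4 * B₀ * C₄ * (ε₄ + B₀ * b) < 1) (hH₁ : ∀ B, ‖kerOp kH₁ B‖ ≤ B₀ * ‖B‖)
    {Φ : (Fin n → ℂ) → (Λb → 𝔇)} {rΦ : ℝ} (hΦd : DifferentiableOn ℂ Φ (ball 0 rΦ)) (hΦ0 : Φ 0 = 0)
    (hΦ : ∀ z ∈ ball (0 : Fin n → ℂ) rΦ, ‖Φ z‖ < b) (h2S : 2 * S ≤ rΦ)
    {C : (Λ' → 𝔄') → (Λx → 𝔅)} {C₂ R : ℝ} (hC₂ : 0 ≤ C₂) (hCq : ∀ Z : Λ' → 𝔄', ‖Z‖ < R → ‖C Z‖ ≤ C₂ * ‖Z‖ ^ 2)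
    (hCd : DifferentiableOn ℂ C (ball 0 R)) (hι : ∀ Y, ‖kerOp kι Y‖ ≤ ‖Y‖) (hH : ∀ X, ‖kerOp kH X‖ ≤ B₀ * ‖X‖)
    (hq : 9 * C₂ * B₀ * (ε₄ + B₀ * b) < 1) (hRC : 6 * (ε₄ + B₀ * b) ≤ R)
    -- localities with reaches and the block support
    (NW : Λz → Λ → Prop) (hlocW : ∀ A A' : Λ → 𝔄, ∀ c, (∀ b', NW c b' → A b' = A' b') → W𝒱 A c = W𝒱 A' c)
    {rW : ℝ} (hreachW : ∀ c b', NW c b' → ϖ (posz c) - rW ≤ ϖ (pos b'))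
    (NC : Λx → Λ' → Prop) (hlocC : ∀ A A' : Λ' → 𝔄', ∀ c, (∀ b', NC c b' → A b' = A' b') → C A c = C A' c)
    {rC : ℝ} (hreachC : ∀ c b', NC c b' → ϖ (posx c) - rC ≤ ϖ (pos' b'))
    (hsupp : ∀ z : Fin n → ℂ, ∀ i, 0 < ϖ (posb i) → Φ z i = 0)
    -- smallness of the two contraction numbers (DISPLAYED arithmetic on the decay constants)
    (hqW : c𝒢 * M𝒢 * (4 * C₄ * (ε₄ + B₀ * b) * Real.exp (δ' * rW)) < 1)
    (hk : 12 * C₂ * (ε₄ + B₀ * b) * Real.exp (δ' * rC) * (cι * Mι) * (cH * MH) < 1)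
    -- the weight read-outs: BLIND off located supports, FLAT op-norms, curl op-norm (DISPLAYED), lengths
    (ℓw : 𝔭 → List ((Λ → 𝔄) →L[ℂ] Matrix nM nM ℂ)) (supp : 𝔭 → Finset Λ) (ϖP : 𝔭 → ℝ)
    (hblind : ∀ p ∈ Pw, ∀ ℓ ∈ ℓw p, ∀ A A' : Λ → 𝔄, (∀ b' ∈ supp p, A b' = A' b') → ℓ A = ℓ A')
    (hdepth : ∀ p ∈ Pw, ∀ b' ∈ supp p, ϖP p ≤ ϖ (pos b')) (hϖP : ∀ p ∈ Pw, 0 ≤ ϖP p)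
    {κw' κc' : ℝ} (hκw' : 0 ≤ κw') (hκc' : 0 ≤ κc') (hℓw : ∀ p ∈ Pw, ∀ ℓ ∈ ℓw p, ‖ℓ‖ ≤ κw')
    (hcurl : ∀ p ∈ Pw, ‖(ℓw p).sum‖ ≤ κc')
    {mw : ℕ} (hlenw : ∀ p ∈ Pw, (ℓw p).length ≤ mw)
    -- the real structure (chain (A)) with SKEW weight read-outs (chain (E))
    (𝓡𝒴 : AddSubgroup (Λ → 𝔄)) (h𝓡𝒴 : IsClosed (𝓡𝒴 : Set (Λ → 𝔄))) (𝓡𝒵 : AddSubgroup (Λz → ℭ))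
    (𝓡𝒴' : AddSubgroup (Λ' → 𝔄')) (𝓡𝒳 : AddSubgroup (Λx → 𝔅)) (h𝓡𝒳 : IsClosed (𝓡𝒳 : Set (Λx → 𝔅)))
    (𝓡ℬ : AddSubgroup (Λb → 𝔇))
    (h𝒢r : ∀ f ∈ 𝓡𝒵, kerOp k𝒢 f ∈ 𝓡𝒴) (hWr : ∀ Y ∈ 𝓡𝒴, W𝒱 Y ∈ 𝓡𝒵) (hιr : ∀ Y ∈ 𝓡𝒴, kerOp kι Y ∈ 𝓡𝒴')
    (hHr : ∀ X ∈ 𝓡𝒳, kerOp kH X ∈ 𝓡𝒴) (hCr : ∀ Z ∈ 𝓡𝒴', C Z ∈ 𝓡𝒳) (hH₁r : ∀ B ∈ 𝓡ℬ, kerOp kH₁ B ∈ 𝓡𝒴)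
    (hΦr : ∀ y : Fin n → ℝ, ‖y‖ ≤ S → Φ (cplx y) ∈ 𝓡ℬ)
    (hskew : ∀ p ∈ Pw, ∀ ℓ ∈ ℓw p, ∀ Y ∈ 𝓡𝒴, ℓ Y ∈ skewAdjoint (Matrix nM nM ℂ))
    -- the frozen background plaquettes (N-ne7cp1-g31-2) and the located count
    (Bp : 𝔭 → Matrix nM nM ℂ) {d : 𝔭 → ℝ} {dbar : ℝ} (hBu : ∀ p ∈ Pw, Bp p ∈ unitary (Matrix nM nM ℂ))
    (hBd : ∀ p ∈ Pw, ‖Bp p - 1‖ ≤ d p) (hd : ∀ p ∈ Pw, d p ≤ dbar) (hdbar : 0 ≤ dbar)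
    {K : ℝ} (hK : ∑ p ∈ Pw, Real.exp (-(δ' * ϖP p)) ≤ K) (β : ℝ) :
    ∀ x ∈ W, ∀ c : ℝ, 1 / 2 ≤ c → c ≤ 1 →
      (fun y => ∑ p ∈ Pw, β * (1 - (Matrix.trace (Bp p * holOf (ℓw p) (fun y => landauExp C (kerOp kι) (kerOp kH)
        (4 * C₂ * (ε₄ + B₀ * b) ^ 2) (solAt (kerOp k𝒢) 0 W𝒱 ε₄ (0 : Λz → ℭ) (kerOp kH₁ (Φ (cplx y))) +
          kerOp kH₁ (Φ (cplx y)))) y)).re / Fintype.card nM)) (c • x) ≤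
      (fun y => ∑ p ∈ Pw, β * (1 - (Matrix.trace (Bp p * holOf (ℓw p) (fun y => landauExp C (kerOp kι) (kerOp kH)
        (4 * C₂ * (ε₄ + B₀ * b) ^ 2) (solAt (kerOp k𝒢) 0 W𝒱 ε₄ (0 : Λz → ℭ) (kerOp kH₁ (Φ (cplx y))) +
          kerOp kH₁ (Φ (cplx y)))) y)).re / Fintype.card nM)) x +
        (1 - c) * (3 * (|β| * ((dbar +
          2 * (κc' * (c₁ * M₁ * b / ((1 - c𝒢 * M𝒢 * (4 * C₄ * (ε₄ + B₀ * b) * Real.exp (δ' * rW))) *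
              (1 - 12 * C₂ * (ε₄ + B₀ * b) * Real.exp (δ' * rC) * (cι * Mι) * (cH * MH)))) +
            expTail₂ (mw * (κw' * (c₁ * M₁ * b / ((1 - c𝒢 * M𝒢 * (4 * C₄ * (ε₄ + B₀ * b) * Real.exp (δ' * rW))) *
              (1 - 12 * C₂ * (ε₄ + B₀ * b) * Real.exp (δ' * rC) * (cι * Mι) * (cH * MH))))))) / (rΦ / S)) *
          (2 * (κc' * (c₁ * M₁ * b / ((1 - c𝒢 * M𝒢 * (4 * C₄ * (ε₄ + B₀ * b) * Real.exp (δ' * rW))) *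
              (1 - 12 * C₂ * (ε₄ + B₀ * b) * Real.exp (δ' * rC) * (cι * Mι) * (cH * MH)))) +
            expTail₂ (mw * (κw' * (c₁ * M₁ * b / ((1 - c𝒢 * M𝒢 * (4 * C₄ * (ε₄ + B₀ * b) * Real.exp (δ' * rW))) *
              (1 - 12 * C₂ * (ε₄ + B₀ * b) * Real.exp (δ' * rC) * (cι * Mι) * (cH * MH))))))) / (rΦ / S))) * K)) := by
  -- the four conjugate bounds from the decay kernels (S69 (A))
  have h𝒢p : ‖kerOpPin k𝒢 δ' (ϖ ∘ posz) (ϖ ∘ pos)‖ ≤ c𝒢 * M𝒢 :=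
    opNorm_kerOpPin_le k𝒢 ρ posz pos ϖ hc𝒢 hδ' hM𝒢 hk𝒢 hϖ hM𝒢'
  have hιp : ‖kerOpPin kι δ' (ϖ ∘ pos) (ϖ ∘ pos')‖ ≤ cι * Mι :=
    opNorm_kerOpPin_le kι ρ pos pos' ϖ hcι hδ' hMι hkι hϖ hMι'
  have hHp : ‖kerOpPin kH δ' (ϖ ∘ posx) (ϖ ∘ pos)‖ ≤ cH * MH :=
    opNorm_kerOpPin_le kH ρ posx pos ϖ hcH hδ' hMH hkH hϖ hMH'
  have hH₁p : ‖kerOpPin kH₁ δ' (ϖ ∘ posb) (ϖ ∘ pos)‖ ≤ c₁ * M₁ :=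
    opNorm_kerOpPin_le kH₁ ρ posb pos ϖ hc₁ hδ' hM₁ hkH₁ hϖ hM₁'
  exact hE_landau_wilsonSquares_located_schwarz_of_kernels_field hS hWS hδ' (ϖ ∘ pos) (ϖ ∘ posz) (ϖ ∘ pos') (ϖ ∘ posx) (ϖ ∘ posb)
    k𝒢 kι kH kH₁ (mul_nonneg hc𝒢 hM𝒢) (mul_nonneg hcι hMι) (mul_nonneg hcH hMH) (mul_nonneg hc₁ hM₁) h𝒢p hιp hHp
    hH₁p h𝒢 hW hB₀ hC₄ hε₄ hdom hself hcontr hH₁ hΦd hΦ0 hΦ h2S hC₂ hCq hCd hι hH hq hRC NW hlocW hreachW NC hlocC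
    hreachC hsupp hqW hk ℓw supp ϖP hblind hdepth hϖP hκw' hκc' hℓw hcurl hlenw 𝓡𝒴 h𝓡𝒴 𝓡𝒵 𝓡𝒴' 𝓡𝒳 h𝓡𝒳 𝓡ℬ
    h𝒢r hWr hιr hHr hCr hH₁r hΦr hskew Bp hBu hBd hd hdbar hK β

end Decay

end Summit.QuantumFields.BalabanUV.T4Continuum.ShellMeasureLandauWilsonSquaresKernelsSchwarzField

end
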